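import Literature.NumberTheory.Automorphic.ArchEndoscopicTorusCayleyFrame     -- ★ B-p12 FILE A: Cayley frame `P`, `cayley_conj_circleDiagonal_mem_archLocal`, `coe_cayley_conj_circleDiagonal(_of_eq)`, `circleDiagonal_mem_archLocal_antidiagOne`
import Literature.NumberTheory.Rogawski1990.ArchHyperbolicOrbitHSBall         -- ★ `diag_mem_unitary_antidiag_iff` (the split torus of `U(Φ₂)`)
import Literature.NumberTheory.Automorphic.ArchStableConjugacyLocalGlobal      -- ★ `archPiEquivCM`, `coe_archPiEquivCM_apply`
import Literature.NumberTheory.Rogawski1990.ArchimedeanTransfer              -- ★ `IsArchGRegular`, `IsArchStablyConjH`, `endoEmbArch`, `coe_endoEmbArch`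
import HarnessLib

/-!
# The Cartan atlas of `H_∞ = U(Φ₂)(L⁺ ⊗ ℝ) × U(Φ₁)(L⁺ ⊗ ℝ)`: the torus families `endoTorus S c` indexed by the split place-set `S`, in ONE coordinate space
# (PART 1 of (T-ATLAS): charts, place components, continuity, wall compatibility; Rogawski 1990 §3.6, §8.2; Shelstad 1979 §4; Bouaziz 1994 §3.2)

Topic `NumberTheory/Automorphic`; namespace `Literature.NumberTheory.Automorphic.UnitaryGroup`.  DEFINITIONS `hypBlockGL`, `endoBlock`, `endoCircle`, `endoTorus` (with
bodies; no instance, no notation, no axiom, no `sorry`) + theorems.  Cell `pub/hodgecm-mathlib`, crux H413 (`stmt-HodgeConjecture-24833`), F0∕P3c line LH3, DIRECT ROAD of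
`stub_N9` (MEMO `F0/P3c/LH3/LH3-plan/g2/MEMO-N9-direct-road.v1∕v2-delta`, D2-SPEC §1); seat LH3-p03 (g2), organ (T-ATLAS) of LH3-plan (g2) DEALER WORDS #6 (g2)
2026-09-02T05:21:09Z.  The chart file the D2∕D2′ predicates (`ArchBouazizSpaceH`, `ArchHCSpaceG`), (EXH), (CUR) and the leaf ED. 3 skeleton import; count-neutral.

THE MATHEMATICS.  `W` = the complex places of the CM field `L` (the index of ★ `archPiEquivCM`).  The Cartan subgroups of `H_∞` up to conjugacy are indexed by
`S : Finset W` (SPLIT at `w ∈ S`, COMPACT at `w ∉ S`).  ONE coordinate space `c : W → Fin 3 → ℝ` serves all charts (D2-SPEC §1, rulings F2∕F3 2026-09-02T05:24:30Z):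
at `w ∉ S` the `U(Φ₂)_w`-block is the Cayley-frame circle torus `P · diag(e^{i c_w0}, e^{i c_w2}) · P⁻¹`, `P = (1 1; 1 −1)` (★ B-p12 `cayley_conj_circleDiagonal_mem_archLocal`;
this is LH3-p04's ★ p849423 family `γ_H(z)` at `z = exp(i c)` and ★ `torusMatrix` of DICH p849157 entrywise), at `w ∈ S` it is the hyperbolic element
`diag(e^{x_w + iθ_w}, e^{−x_w + iθ_w})`, `x_w := c w 0`, `θ_w := c w 2` (∈ `U(Φ₂)_w` by ★ `diag_mem_unitary_antidiag_iff`), and the `U(Φ₁)_w`-entry is `e^{i c_w1}` in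
both cases.  `endoTorus S c ∈ H_∞` assembles the place components through `(archPiEquivCM 2 L Φ₂)⁻¹ × (archPiEquivCM 1 L Φ₁)⁻¹`.  WALL COMPATIBILITY (the Cayley
point of F2): at an imaginary wall `c w 0 = c w 2` (`w ∉ S`) the compact block is the scalar `e^{iθ}·1` (★ `coe_cayley_conj_circleDiagonal_of_eq`), which IS the `x = 0` point
of the split chart at `w`: `endoTorus S c = endoTorus (insert w S) (c with x_w := 0, θ_w := c w 0)` — the identity through which the jump relations (I₃) compare the two
neighbouring charts.
* `hypBlockGL x θ` + `coe_hypBlockGL`, `hypBlockGL_mem_archLocal`; `endoBlock S c w`, `endoCircle c w`; **`endoTorus S c`**;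
* `archPiEquivCM_endoTorus_fst∕snd` (place components), `coe_archPiEquivCM_endoTorus_fst_of_mem∕_of_not_mem` (their matrices), `continuous_endoTorus`;
* **`endoTorus_of_wall`** (Cayley-point compatibility), `endoTorus_congr` (the chart only reads `c w 0, c w 1, c w 2`).
PART 2 (next editions): `G`-regularity in coordinates, centralisers on the charts, the stable flip at `w ∉ S`, the realised reflection `x ↦ −x` at `w ∈ S`, (EXH-H); the
`G′`-side charts `gprimeTorus`.  The coordinate-level sets∕normalisers (`RegS`, `archRH`, `cayPt`) are LH3-p01 (g3)'s (COORD) file and are docked by one-line lemmas there∕here.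
HONEST LABEL: HC_CM is proved only modulo the 7 printed citations (2 remaining: hLiu418 = `stmt-HodgeConjecture-24832`, h413 = `stmt-HodgeConjecture-24833`) until rung 0
closes; this is a chart file (definitions with bodies + bookkeeping), count-neutral (+0∕+0).

## References
* [Rogawski1990] J. D. Rogawski, *Automorphic Representations of Unitary Groups in Three Variables*, Ann. of Math. Stud. 123 (1990), §3.6 p. 31 (Cartan subgroups of unitary
  groups), §4.9 p. 54 (`H = U(2) × U(1)`), §8.2 pp. 122–123 (the compact Cartan, coordinates `γ(θ, φ, ψ)`), §14.3 p. 234.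
* [Shelstad1979] D. Shelstad, *Characters and inner forms of a quasi-split group over ℝ*, Compositio Math. 39 (1979), §4 pp. 22–23 (Cartan subgroups `T`, `T_reg`, adjacent Cartans
  through the Cayley transform).
* [Bouaziz1994IntegralesOrbitales] A. Bouaziz, *Intégrales orbitales sur les groupes de Lie réductifs*, Ann. Sci. ÉNS 27 (1994), §3.2 pp. 579–580 (jump data `(s, H, H′)`).
* [Knapp1986] A. W. Knapp, *Representation Theory of Semisimple Groups* (1986), Ch. V §3 (Cartan subgroups of `SU(1,1)`, `SU(2,1)`).
-/

set_option autoImplicit false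

noncomputable section

open NumberField NumberField.InfinitePlace NumberField.mixedEmbedding Matrix Complex
open scoped MatrixGroups Matrix ComplexConjugate Real Classical

namespace Literature.NumberTheory.Automorphic.UnitaryGroup

open Literature.NumberTheory.Rogawski1990

/-! ## §1 The two `U(Φ₂)`-blocks at a complex place -/

section Blocks

/-- The determinant of the hyperbolic block `diag(e^{x+iθ}, e^{−x+iθ})` is `e^{2iθ} ≠ 0`. [cite: Rogawski1990, §3.6 p. 31] -/
theorem det_hypBlock_ne_zero (x θ : ℝ) :
    Matrix.det !![Complex.exp ((x : ℂ) + (θ : ℂ) * I), 0; 0, Complex.exp (-(x : ℂ) + (θ : ℂ) * I)] ≠ 0 := by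
  rw [Matrix.det_fin_two_of]
  simp [Complex.exp_ne_zero]

/-- **The hyperbolic block `diag(e^{x+iθ}, e^{−x+iθ}) ∈ GL₂(ℂ)`** — the SPLIT Cartan of `U(Φ₂)(ℂ) = U(1,1)` in Rogawski's antidiagonal frame (eigenvalues `e^{±x+iθ}`,
real root `ξ = e^{2x}`); coordinates `x` (half log-modulus difference), `θ` (common argument). [cite: Rogawski1990, §3.6 p. 31] [cite: Knapp1986, Ch. V §3] -/
def hypBlockGL (x θ : ℝ) : GL (Fin 2) ℂ :=
  Matrix.GeneralLinearGroup.mkOfDetNeZero !![Complex.exp ((x : ℂ) + (θ : ℂ) * I), 0; 0, Complex.exp (-(x : ℂ) + (θ : ℂ) * I)] (det_hypBlock_ne_zero x θ)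

/-- The matrix of `hypBlockGL x θ`. [cite: Rogawski1990, §3.6 p. 31] -/
@[simp] theorem coe_hypBlockGL (x θ : ℝ) :
    ((hypBlockGL x θ : GL (Fin 2) ℂ) : Matrix (Fin 2) (Fin 2) ℂ) = !![Complex.exp ((x : ℂ) + (θ : ℂ) * I), 0; 0, Complex.exp (-(x : ℂ) + (θ : ℂ) * I)] := by
  rw [hypBlockGL, Matrix.GeneralLinearGroup.val_mkOfDetNeZero]

/-- `conj(e^{x+iθ}) · e^{−x+iθ} = 1`: the unitarity relation of the split torus. [cite: Rogawski1990, §3.6 p. 31] -/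
theorem conj_exp_mul_exp_eq_one (x θ : ℝ) : conj (Complex.exp ((x : ℂ) + (θ : ℂ) * I)) * Complex.exp (-(x : ℂ) + (θ : ℂ) * I) = 1 := by
  rw [← Complex.exp_conj, ← Complex.exp_add, map_add, map_mul, Complex.conj_ofReal, Complex.conj_ofReal, Complex.conj_I]
  have : (x : ℂ) + (θ : ℂ) * -I + (-(x : ℂ) + (θ : ℂ) * I) = 0 := by ring
  rw [this, Complex.exp_zero]

/-- `diag(e^{x+iθ}, e^{−x+iθ})⁻¹ = diag(e^{−x−iθ}, e^{x−iθ})`. [cite: Rogawski1990, §3.6 p. 31] -/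
theorem hypBlockGL_inv (x θ : ℝ) : (hypBlockGL x θ)⁻¹ = hypBlockGL (-x) (-θ) := by
  rw [inv_eq_iff_mul_eq_one]
  refine Matrix.GeneralLinearGroup.ext fun i j => ?_
  rw [Units.val_mul, coe_hypBlockGL, coe_hypBlockGL, Units.val_one]
  fin_cases i <;> fin_cases j <;> simp [Matrix.mul_apply, Fin.sum_univ_two, ← Complex.exp_add] <;> ring_nf <;> simp

/-- `(x, θ) ↦ diag(e^{x+iθ}, e^{−x+iθ})` is continuous. [cite: Rogawski1990, §3.6 p. 31] -/
theorem continuous_hypBlockGL : Continuous fun p : ℝ × ℝ => hypBlockGL p.1 p.2 := by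
  have hval : ∀ f : ℝ × ℝ → ℝ × ℝ, Continuous f → Continuous fun p : ℝ × ℝ => ((hypBlockGL (f p).1 (f p).2 : GL (Fin 2) ℂ) : Matrix (Fin 2) (Fin 2) ℂ) := by
    intro f hf
    simp only [coe_hypBlockGL]
    have h0 : Continuous fun p : ℝ × ℝ => ((f p).1 : ℂ) := Complex.continuous_ofReal.comp (continuous_fst.comp hf)
    have h2 : Continuous fun p : ℝ × ℝ => ((f p).2 : ℂ) := Complex.continuous_ofReal.comp (continuous_snd.comp hf)
    refine continuous_matrix fun i j => ?_
    fin_cases i <;> fin_cases j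
    · exact Complex.continuous_exp.comp (h0.add (h2.mul continuous_const))
    · exact continuous_const
    · exact continuous_const
    · exact Complex.continuous_exp.comp (h0.neg.add (h2.mul continuous_const))
  refine Units.continuous_iff.mpr ⟨hval id continuous_id, ?_⟩
  have e : (fun p : ℝ × ℝ => (((hypBlockGL p.1 p.2)⁻¹ : GL (Fin 2) ℂ) : Matrix (Fin 2) (Fin 2) ℂ)) =
      fun p : ℝ × ℝ => ((hypBlockGL ((-p.1, -p.2) : ℝ × ℝ).1 ((-p.1, -p.2) : ℝ × ℝ).2 : GL (Fin 2) ℂ) : Matrix (Fin 2) (Fin 2) ℂ) := by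
    funext p; rw [hypBlockGL_inv]
  show Continuous fun p : ℝ × ℝ => (((hypBlockGL p.1 p.2)⁻¹ : GL (Fin 2) ℂ) : Matrix (Fin 2) (Fin 2) ℂ)
  rw [e]
  exact hval _ (continuous_fst.neg.prodMk continuous_snd.neg)

variable (L : Type) [Field L] (w : {w : InfinitePlace L // IsComplex w})

/-- **`diag(e^{x+iθ}, e^{−x+iθ}) ∈ U(Φ₂)_w`** at every complex place (★ `diag_mem_unitary_antidiag_iff`, `σ_w Φ₂ = Φ₂`). [cite: Rogawski1990, §3.6 p. 31] -/
theorem hypBlockGL_mem_archLocal (x θ : ℝ) :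
    hypBlockGL x θ ∈ archLocal L 2 (Matrix.of fun i j : Fin 2 => if i.val + j.val + 1 = 2 then (1 : L) else 0) w := by
  rw [mem_archLocal_iff, Literature.NumberTheory.Rogawski1990.antidiagOne_map, coe_hypBlockGL]
  have h := (Literature.NumberTheory.Rogawski1990.diag_mem_unitary_antidiag_iff (Complex.exp ((x : ℂ) + (θ : ℂ) * I)) (Complex.exp (-(x : ℂ) + (θ : ℂ) * I))).2
    (conj_exp_mul_exp_eq_one x θ)
  convert h using 2

end Blocks

/-! ## §2 The charts `endoTorus S c` of `H_∞` -/

section PlaceCharts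

variable (L : Type) [Field L]

/-- **The `U(Φ₂)_w`-component of the chart `S`**: the hyperbolic block `diag(e^{x_w+iθ_w}, e^{−x_w+iθ_w})` (`x_w = c w 0`, `θ_w = c w 2`) at a split place `w ∈ S`, the
Cayley-frame circle block `P·diag(e^{i c_w0}, e^{i c_w2})·P⁻¹` at a compact place `w ∉ S`. [cite: Rogawski1990, §3.6 p. 31; §8.2 p. 122] [cite: Shelstad1979, §4 p. 22] -/
def endoBlock (S : Finset {w : InfinitePlace L // IsComplex w}) (c : {w : InfinitePlace L // IsComplex w} → Fin 3 → ℝ) (w : {w : InfinitePlace L // IsComplex w}) :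
    ↥(archLocal L 2 (Matrix.of fun i j : Fin 2 => if i.val + j.val + 1 = 2 then (1 : L) else 0) w) :=
  if w ∈ S then ⟨hypBlockGL (c w 0) (c w 2), hypBlockGL_mem_archLocal L w (c w 0) (c w 2)⟩
  else ⟨Matrix.GeneralLinearGroup.mkOfDetNeZero !![(1 : ℂ), 1; 1, -1] det_cayleyTwo_ne_zero *
        circleDiagonal 2 ![Circle.exp (c w 0), Circle.exp (c w 2)] *
      (Matrix.GeneralLinearGroup.mkOfDetNeZero !![(1 : ℂ), 1; 1, -1] det_cayleyTwo_ne_zero)⁻¹,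
      cayley_conj_circleDiagonal_mem_archLocal L w _⟩

/-- **The `U(Φ₁)_w`-component** `e^{i c_w1}` (the same in every chart). [cite: Rogawski1990, §4.9 p. 54] -/
def endoCircle (c : {w : InfinitePlace L // IsComplex w} → Fin 3 → ℝ) (w : {w : InfinitePlace L // IsComplex w}) :
    ↥(archLocal L 1 (Matrix.of fun i j : Fin 1 => if i.val + j.val + 1 = 1 then (1 : L) else 0) w) :=
  ⟨circleDiagonal 1 ![Circle.exp (c w 1)], circleDiagonal_mem_archLocal_antidiagOne L w _⟩

/-- At a SPLIT place the `2`-block matrix is `diag(e^{x_w+iθ_w}, e^{−x_w+iθ_w})`. [cite: Rogawski1990, §3.6 p. 31] -/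
theorem coe_endoBlock_of_mem {S : Finset {w : InfinitePlace L // IsComplex w}} (c : {w : InfinitePlace L // IsComplex w} → Fin 3 → ℝ)
    {w : {w : InfinitePlace L // IsComplex w}} (hw : w ∈ S) :
    ((endoBlock L S c w : GL (Fin 2) ℂ) : Matrix (Fin 2) (Fin 2) ℂ) =
      !![Complex.exp ((c w 0 : ℂ) + (c w 2 : ℂ) * I), 0; 0, Complex.exp (-(c w 0 : ℂ) + (c w 2 : ℂ) * I)] := by
  unfold endoBlock
  rw [if_pos hw]
  exact coe_hypBlockGL _ _

/-- At a COMPACT place the `2`-block matrix is `½ (a+b  a−b; a−b  a+b)`, `a = e^{i c_w0}`, `b = e^{i c_w2}` (★ `coe_cayley_conj_circleDiagonal`). [cite: Rogawski1990, §8.2 p. 122] -/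
theorem coe_endoBlock_of_not_mem {S : Finset {w : InfinitePlace L // IsComplex w}} (c : {w : InfinitePlace L // IsComplex w} → Fin 3 → ℝ)
    {w : {w : InfinitePlace L // IsComplex w}} (hw : w ∉ S) :
    ((endoBlock L S c w : GL (Fin 2) ℂ) : Matrix (Fin 2) (Fin 2) ℂ) =
      !![((Circle.exp (c w 0) : ℂ) + Circle.exp (c w 2)) / 2, ((Circle.exp (c w 0) : ℂ) - Circle.exp (c w 2)) / 2;
         ((Circle.exp (c w 0) : ℂ) - Circle.exp (c w 2)) / 2, ((Circle.exp (c w 0) : ℂ) + Circle.exp (c w 2)) / 2] := by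
  unfold endoBlock
  rw [if_neg hw]
  exact coe_cayley_conj_circleDiagonal ![Circle.exp (c w 0), Circle.exp (c w 2)]

/-- The `U(Φ₁)_w`-entry is `e^{i c_w1}`. [cite: Rogawski1990, §4.9 p. 54] -/
theorem coe_endoCircle (c : {w : InfinitePlace L // IsComplex w} → Fin 3 → ℝ) (w : {w : InfinitePlace L // IsComplex w}) :
    ((endoCircle L c w : GL (Fin 1) ℂ) : Matrix (Fin 1) (Fin 1) ℂ) = Matrix.diagonal fun _ => (Circle.exp (c w 1) : ℂ) := by
  rw [endoCircle, coe_circleDiagonal]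
  congr 1
  funext i
  fin_cases i
  rfl

end PlaceCharts

section Charts

variable (L : Type) [Field L] [NumberField L] [IsCMField L]

/-- **THE CHART `endoTorus S c ∈ H_∞ = U(Φ₂)(L⁺ ⊗ ℝ) × U(Φ₁)(L⁺ ⊗ ℝ)`** — the torus family of the Cartan class `S` (split at `w ∈ S`, compact at `w ∉ S`) in the common
coordinates `c : W → Fin 3 → ℝ`, assembled from its place components through ★ `archPiEquivCM`. [cite: Rogawski1990, §3.6 p. 31; §8.2 p. 122] [cite: Shelstad1979, §4 p. 22]
[cite: Bouaziz1994IntegralesOrbitales, §3.2 p. 579] -/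
def endoTorus (S : Finset {w : InfinitePlace L // IsComplex w}) (c : {w : InfinitePlace L // IsComplex w} → Fin 3 → ℝ) :
    ↥(arch (↥(maximalRealSubfield L)) L (IsCMField.complexConj L) 2 (Matrix.of fun i j : Fin 2 => if i.val + j.val + 1 = 2 then (1 : L) else 0)) ×
      ↥(arch (↥(maximalRealSubfield L)) L (IsCMField.complexConj L) 1 (Matrix.of fun i j : Fin 1 => if i.val + j.val + 1 = 1 then (1 : L) else 0)) :=
  ((archPiEquivCM 2 L (Matrix.of fun i j : Fin 2 => if i.val + j.val + 1 = 2 then (1 : L) else 0)).symm (endoBlock L S c),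
    (archPiEquivCM 1 L (Matrix.of fun i j : Fin 1 => if i.val + j.val + 1 = 1 then (1 : L) else 0)).symm (endoCircle L c))

variable (S : Finset {w : InfinitePlace L // IsComplex w}) (c : {w : InfinitePlace L // IsComplex w} → Fin 3 → ℝ) (w : {w : InfinitePlace L // IsComplex w})

/-- The `U(Φ₂)_w`-component of `endoTorus S c` is `endoBlock S c w`. [cite: Rogawski1990, §8.2 p. 122] -/
@[simp] theorem archPiEquivCM_endoTorus_fst :
    archPiEquivCM 2 L (Matrix.of fun i j : Fin 2 => if i.val + j.val + 1 = 2 then (1 : L) else 0) (endoTorus L S c).1 w = endoBlock L S c w := by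
  rw [endoTorus, ContinuousMulEquiv.apply_symm_apply]

/-- The `U(Φ₁)_w`-component of `endoTorus S c` is `endoCircle c w`. [cite: Rogawski1990, §4.9 p. 54] -/
@[simp] theorem archPiEquivCM_endoTorus_snd :
    archPiEquivCM 1 L (Matrix.of fun i j : Fin 1 => if i.val + j.val + 1 = 1 then (1 : L) else 0) (endoTorus L S c).2 w = endoCircle L c w := by
  rw [endoTorus, ContinuousMulEquiv.apply_symm_apply]

/-- **DOCK WITH THE ALL-COMPACT FAMILY `γ_H(z)` of ★ p849423 ∕ ★ p849489 §4** (LH3-p04's (W1-torus), LH3-p01's (CONT-H-ell) Cayley corollary): at `S = ∅` the chart is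
LITERALLY their Cayley-frame family at `z = exp(i c)` — so their continuity heads apply to `endoTorus ∅` by `rw`. [cite: Rogawski1990, §8.2 p. 122] -/
theorem endoTorus_empty (c : {w : InfinitePlace L // IsComplex w} → Fin 3 → ℝ) :
    endoTorus L ∅ c =
      ((archPiEquivCM 2 L (Matrix.of fun i j : Fin 2 => if i.val + j.val + 1 = 2 then (1 : L) else 0)).symm fun w =>
          ⟨Matrix.GeneralLinearGroup.mkOfDetNeZero !![(1 : ℂ), 1; 1, -1] det_cayleyTwo_ne_zero *
              circleDiagonal 2 ![Circle.exp (c w 0), Circle.exp (c w 2)] *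
            (Matrix.GeneralLinearGroup.mkOfDetNeZero !![(1 : ℂ), 1; 1, -1] det_cayleyTwo_ne_zero)⁻¹,
            cayley_conj_circleDiagonal_mem_archLocal L w _⟩,
        (archPiEquivCM 1 L (Matrix.of fun i j : Fin 1 => if i.val + j.val + 1 = 1 then (1 : L) else 0)).symm fun w =>
          ⟨circleDiagonal 1 ![Circle.exp (c w 1)], circleDiagonal_mem_archLocal_antidiagOne L w _⟩) := by
  unfold endoTorus endoCircle endoBlock
  simp only [Finset.notMem_empty, if_false]

/-- **The chart only reads the three coordinates at each place**: `endoTorus S c = endoTorus S c′` whenever `c w i = c′ w i` for all `w, i`. (Bookkeeping for the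
coordinate updates of (COORD).) [cite: Rogawski1990, §8.2 p. 122] -/
theorem endoTorus_congr {c c' : {w : InfinitePlace L // IsComplex w} → Fin 3 → ℝ} (h : ∀ w i, c w i = c' w i) : endoTorus L S c = endoTorus L S c' := by
  have : c = c' := funext fun w => funext fun i => h w i
  rw [this]

/-- **`endoTorus S` is continuous in the coordinates** (★ `archPiEquivCM` is a homeomorphism; `exp`, `circleDiagonal` continuous; the `if` is on the fixed set `S`).
[cite: Rogawski1990, §8.2 p. 122] -/
theorem continuous_endoTorus : Continuous (endoTorus L S) := by
  refine Continuous.prodMk ?_ ?_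
  · refine (archPiEquivCM 2 L _).symm.continuous.comp (continuous_pi fun w => ?_)
    by_cases hw : w ∈ S
    · have h : (fun c : {w : InfinitePlace L // IsComplex w} → Fin 3 → ℝ => endoBlock L S c w) =
          fun c => ⟨hypBlockGL (c w 0) (c w 2), hypBlockGL_mem_archLocal L w (c w 0) (c w 2)⟩ := by
        funext c; unfold endoBlock; rw [if_pos hw]
      rw [h]
      refine Continuous.subtype_mk ?_ _
      have hc : Continuous fun c : {w : InfinitePlace L // IsComplex w} → Fin 3 → ℝ => ((c w 0, c w 2) : ℝ × ℝ) :=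
        ((continuous_apply 0).comp (continuous_apply w)).prodMk ((continuous_apply 2).comp (continuous_apply w))
      exact continuous_hypBlockGL.comp hc
    · have h : (fun c : {w : InfinitePlace L // IsComplex w} → Fin 3 → ℝ => endoBlock L S c w) =
          fun c => ⟨Matrix.GeneralLinearGroup.mkOfDetNeZero !![(1 : ℂ), 1; 1, -1] det_cayleyTwo_ne_zero *
              circleDiagonal 2 ![Circle.exp (c w 0), Circle.exp (c w 2)] *
            (Matrix.GeneralLinearGroup.mkOfDetNeZero !![(1 : ℂ), 1; 1, -1] det_cayleyTwo_ne_zero)⁻¹,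
            cayley_conj_circleDiagonal_mem_archLocal L w _⟩ := by
        funext c; unfold endoBlock; rw [if_neg hw]
      rw [h]
      refine Continuous.subtype_mk ?_ _
      have hv : Continuous fun c : {w : InfinitePlace L // IsComplex w} → Fin 3 → ℝ => ![Circle.exp (c w 0), Circle.exp (c w 2)] := by
        have h0 : Continuous fun c : {w : InfinitePlace L // IsComplex w} → Fin 3 → ℝ => Circle.exp (c w 0) :=
          Circle.exp.continuous.comp ((continuous_apply 0).comp (continuous_apply w))
        have h2 : Continuous fun c : {w : InfinitePlace L // IsComplex w} → Fin 3 → ℝ => Circle.exp (c w 2) :=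
          Circle.exp.continuous.comp ((continuous_apply 2).comp (continuous_apply w))
        exact continuous_pi fun i => by fin_cases i <;> assumption
      exact (continuous_const.mul ((continuous_circleDiagonal 2).comp hv)).mul continuous_const
  · refine (archPiEquivCM 1 L _).symm.continuous.comp (continuous_pi fun w => ?_)
    refine Continuous.subtype_mk ?_ _
    have hv : Continuous fun c : {w : InfinitePlace L // IsComplex w} → Fin 3 → ℝ => ![Circle.exp (c w 1)] := by
      have h1 : Continuous fun c : {w : InfinitePlace L // IsComplex w} → Fin 3 → ℝ => Circle.exp (c w 1) :=
        Circle.exp.continuous.comp ((continuous_apply 1).comp (continuous_apply w))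
      exact continuous_pi fun i => by fin_cases i; assumption
    exact (continuous_circleDiagonal 1).comp hv

/-! ### Wall compatibility: the Cayley point (ruling F2) -/

variable {S w} in
/-- **WALL COMPATIBILITY (the Cayley point).**  At an imaginary wall `c w 0 = c w 2` of the chart `S` (`w ∉ S`) the compact block is the scalar `e^{iθ}·1`
(★ `coe_cayley_conj_circleDiagonal_of_eq`), which is the `x_w = 0` point of the SPLIT chart at `w`: `endoTorus S c = endoTorus (insert w S) c′` with `c′ w = (0, c w 1, c w 0)`
(`x_w := 0`, `θ_w := c w 0`, ruling F2's `cayPt`) and `c′ = c` off `w`.  The identity through which the jump relations (I₃) compare the charts `S` and `insert w S`.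
[cite: Shelstad1979, §4 pp. 22–23] [cite: Bouaziz1994IntegralesOrbitales, §3.2 p. 580] [cite: Rogawski1990, §8.2 p. 123] -/
theorem endoTorus_of_wall (hw : w ∉ S) (h : c w 0 = c w 2) :
    endoTorus L S c = endoTorus L (insert w S) (Function.update c w ![0, c w 1, c w 0]) := by
  unfold endoTorus
  congr 1
  · congr 1
    funext v
    by_cases hv : v = w
    · subst hv
      apply Subtype.ext
      have h1 : ((endoBlock L S c v : GL (Fin 2) ℂ) : Matrix (Fin 2) (Fin 2) ℂ) = Matrix.diagonal fun _ => (Circle.exp (c v 0) : ℂ) := by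
        rw [coe_endoBlock_of_not_mem L c hw, ← h]
        ext i j
        fin_cases i <;> fin_cases j <;> simp [Matrix.diagonal]
      have h2 : ((endoBlock L (insert v S) (Function.update c v ![0, c v 1, c v 0]) v : GL (Fin 2) ℂ) : Matrix (Fin 2) (Fin 2) ℂ) =
          Matrix.diagonal fun _ => (Circle.exp (c v 0) : ℂ) := by
        rw [coe_endoBlock_of_mem L _ (Finset.mem_insert_self v S)]
        simp only [Function.update_self, Matrix.cons_val_zero]
        have e2 : ((![(0 : ℝ), c v 1, c v 0] : Fin 3 → ℝ) 2 : ℝ) = c v 0 := rfl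
        rw [e2, Circle.coe_exp]
        ext i j
        fin_cases i <;> fin_cases j <;> simp [Matrix.diagonal]
      exact Matrix.GeneralLinearGroup.ext fun i j => by rw [h1, h2]
    · have hmem : (v ∈ insert w S) ↔ v ∈ S := by simp [Finset.mem_insert, hv]
      apply Subtype.ext
      unfold endoBlock
      simp only [Function.update_of_ne hv]
      by_cases hvS : v ∈ S
      · rw [if_pos hvS, if_pos (hmem.2 hvS)]
      · rw [if_neg hvS, if_neg (fun h' => hvS (hmem.1 h'))]
  · congr 1
    funext v
    by_cases hv : v = w
    · subst hv
      simp only [endoCircle, Function.update_self]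
      rfl
    · simp only [endoCircle, Function.update_of_ne hv]

end Charts

end Literature.NumberTheory.Automorphic.UnitaryGroup

end
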